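import Literature.MathematicalPhysics.StatisticalMechanics.TorusFRDKernels
import HarnessLib

/-!
# Dyadic lattice sums on the dual torus

Topic `Literature/MathematicalPhysics/StatisticalMechanics`.  The Riemann-sum estimate behind the
real-space bounds of the finite-range decomposition (Buchholz, J. Funct. Anal. 275 (2018), App. A,
(A.12)–(A.16): "we split the sum over the dual torus into the annuli `𝔸_j`"): for `d ≥ 3`, `s ≥ 0` and
`2j ≥ d − 1 + s` there is `C = C(d,s,j)` such that for every side length `M` and every `R > 0`

  `M^{-d} Σ_{κ ≠ 0} |p(κ)|^{s-2} min(1, (R|p(κ)|)^{-2j}) ≤ C min(1, R^{-(d-2+s)})`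

(`exists_latticeSum_le`), where `p(κ) = 2πκ̃/M` is the dual momentum of the statement file.  The proof
groups `κ` dyadically by `|κ̃|_∞ ∈ [2^m, 2^{m+1})` (`≤ (2^{m+2})^d` points, on which
`2π 2^m/M ≤ |p| ≤ 2πd 2^{m+1}/M`) and sums two geometric series meeting at `|p| ≈ 1/R`.

Everything is proved; no named facts.

## References
* S. Buchholz, *Finite range decomposition for Gaussian measures with improved regularity*,
  J. Funct. Anal. 275 (2018), App. A (A.12)–(A.16) [Buchholz2016].
-/

noncomputable section

namespace Literature.MathematicalPhysics.StatisticalMechanics.GradientFRD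

open Finset Literature.Probability.LatticeModels
open scoped Real BigOperators

variable {d M : ℕ} [NeZero M]

/-! ## `|p|` versus `|κ̃|_∞` -/

omit [NeZero M] in
/-- `|p(κ)| ≥ (2π/M) |κ̃|_∞`. [cite: Buchholz2016, App. A (A.14)] -/
theorem supNorm_le_momNorm (κ : Fin d → ZMod M) : 2 * π / M * (supNorm κ : ℝ) ≤ momNorm κ := by
  rcases Nat.eq_zero_or_pos d with hd | hd
  · subst hd
    have : supNorm κ = 0 := by unfold supNorm; simp
    rw [this]; simp [momNorm_nonneg]
  · haveI : Nonempty (Fin d) := Fin.pos_iff_nonempty.1 hd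
    obtain ⟨i, _, hi⟩ := Finset.exists_mem_eq_sup (Finset.univ : Finset (Fin d)) Finset.univ_nonempty
      (fun i => ((κ i).valMinAbs).natAbs)
    have hsup : (supNorm κ : ℝ) = |((κ i).valMinAbs : ℝ)| := by
      rw [supNorm, hi, ← Int.cast_natCast, Int.natCast_natAbs, Int.cast_abs]
    rw [momNorm]
    refine Real.le_sqrt_of_sq_le ?_
    calc (2 * π / M * (supNorm κ : ℝ)) ^ 2 = dualMomentum κ i ^ 2 := by
          rw [hsup, dualMomentum]
          rw [show 2 * π * ((κ i).valMinAbs : ℝ) / M = 2 * π / M * ((κ i).valMinAbs : ℝ) by ring, mul_pow, mul_pow,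
            sq_abs]
      _ ≤ ∑ i', dualMomentum κ i' ^ 2 :=
          Finset.single_le_sum (f := fun i' => dualMomentum κ i' ^ 2) (fun _ _ => sq_nonneg _) (Finset.mem_univ i)

/-- `|p(κ)| ≤ (2πd/M) |κ̃|_∞`. [cite: Buchholz2016, App. A (A.14)] -/
theorem momNorm_le_supNorm (κ : Fin d → ZMod M) : momNorm κ ≤ 2 * π * d / M * (supNorm κ : ℝ) := by
  have hM : (0 : ℝ) < M := by exact_mod_cast Nat.pos_of_ne_zero (NeZero.ne M)
  have hcoord : ∀ i, dualMomentum κ i ^ 2 ≤ (2 * π / M * (supNorm κ : ℝ)) ^ 2 := by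
    intro i
    have h1 : |((κ i).valMinAbs : ℝ)| ≤ supNorm κ := by
      rw [← Int.cast_abs, ← Int.natCast_natAbs, Int.cast_natCast]
      exact_mod_cast natAbs_valMinAbs_le_supNorm κ i
    rw [dualMomentum, show 2 * π * ((κ i).valMinAbs : ℝ) / M = 2 * π / M * ((κ i).valMinAbs : ℝ) by ring, mul_pow,
      mul_pow, ← sq_abs ((κ i).valMinAbs : ℝ)]
    gcongr
  have hsum : ∑ i, dualMomentum κ i ^ 2 ≤ d * (2 * π / M * (supNorm κ : ℝ)) ^ 2 := by
    calc ∑ i, dualMomentum κ i ^ 2 ≤ ∑ _i : Fin d, (2 * π / M * (supNorm κ : ℝ)) ^ 2 := sum_le_sum fun i _ => hcoord i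
      _ = d * (2 * π / M * (supNorm κ : ℝ)) ^ 2 := by rw [sum_const, card_univ, Fintype.card_fin, nsmul_eq_mul]
  rw [momNorm]
  refine (Real.sqrt_le_sqrt hsum).trans ?_
  have hd1 : (d : ℝ) ≤ (d : ℝ) ^ 2 := by
    rcases Nat.eq_zero_or_pos d with h | h
    · subst h; simp
    · have : (1 : ℝ) ≤ d := by exact_mod_cast h
      nlinarith
  calc Real.sqrt (d * (2 * π / M * (supNorm κ : ℝ)) ^ 2) ≤ Real.sqrt ((d : ℝ) ^ 2 * (2 * π / M * (supNorm κ : ℝ)) ^ 2) :=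
        Real.sqrt_le_sqrt (by gcongr)
    _ = d * (2 * π / M * (supNorm κ : ℝ)) := by
        rw [← mul_pow, Real.sqrt_sq (by positivity)]
    _ = 2 * π * d / M * (supNorm κ : ℝ) := by ring

omit [NeZero M] in
/-- `1 ≤ |κ̃|_∞` for `κ ≠ 0`. [cite: Buchholz2016, §2 (the metric d_∞ on T_N)] -/
theorem one_le_supNorm {κ : Fin d → ZMod M} (hκ : κ ≠ 0) : 1 ≤ supNorm κ := by
  by_contra h
  exact hκ ((supNorm_eq_zero_iff κ).1 (by omega))

/-- `|κ̃|_∞ ≤ M/2 ≤ M`. [cite: Buchholz2016, §2 (the metric d_∞ on T_N)] -/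
theorem supNorm_le (κ : Fin d → ZMod M) : supNorm κ ≤ M := by
  unfold supNorm
  refine Finset.sup_le fun i _ => (ZMod.natAbs_valMinAbs_le (κ i)).trans (Nat.div_le_self _ _)

/-- `|p(κ)| > 0` for `κ ≠ 0`. [cite: Buchholz2016, §2 (2.20)] -/
theorem momNorm_pos {κ : Fin d → ZMod M} (hκ : κ ≠ 0) : 0 < momNorm κ := by
  have hM : (0 : ℝ) < M := by exact_mod_cast Nat.pos_of_ne_zero (NeZero.ne M)
  have h1 : (1 : ℝ) ≤ supNorm κ := by exact_mod_cast one_le_supNorm hκ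
  exact lt_of_lt_of_le (by positivity) (supNorm_le_momNorm κ)

/-! ## Counting a dyadic block -/

/-- The number of `κ` with `|κ̃|_∞ < 2^{m+1}` is at most `(2^{m+2})^d`. [cite: Buchholz2016, App. A (A.15)] -/
theorem card_supNorm_lt_le (m : ℕ) :
    ((Finset.univ.filter fun κ : Fin d → ZMod M => supNorm κ < 2 ^ (m + 1)).card : ℕ) ≤ (2 ^ (m + 2)) ^ d := by
  classical
  set S : Finset ℤ := Finset.Ioo (-(2 ^ (m + 1) : ℤ)) (2 ^ (m + 1)) with hS
  have hcardS : S.card ≤ 2 ^ (m + 2) := by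
    rw [hS, Int.card_Ioo]
    have : (2 : ℤ) ^ (m + 1) - -2 ^ (m + 1) - 1 = ((2 ^ (m + 2) - 1 : ℕ) : ℤ) := by
      have h1 : 1 ≤ 2 ^ (m + 2) := Nat.one_le_two_pow
      push_cast [Nat.cast_sub h1]
      ring
    rw [this, Int.toNat_natCast]
    omega
  set f : (Fin d → ZMod M) → (Fin d → ℤ) := fun κ i => (κ i).valMinAbs with hf
  have hmaps : Set.MapsTo f ↑(Finset.univ.filter fun κ : Fin d → ZMod M => supNorm κ < 2 ^ (m + 1))
      ↑(Fintype.piFinset fun _ : Fin d => S) := by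
    intro κ hκ
    rw [Finset.coe_filter, Set.mem_setOf_eq] at hκ
    rw [Finset.mem_coe, Fintype.mem_piFinset]
    intro i
    rw [hS, Finset.mem_Ioo]
    have h1 : ((κ i).valMinAbs).natAbs < 2 ^ (m + 1) := lt_of_le_of_lt (natAbs_valMinAbs_le_supNorm κ i) hκ.2
    have h2 : (((κ i).valMinAbs).natAbs : ℤ) < ((2 ^ (m + 1) : ℕ) : ℤ) := by exact_mod_cast h1
    rw [Int.natCast_natAbs] at h2
    push_cast at h2
    simp only [hf]
    constructor <;> [linarith [neg_abs_le ((κ i).valMinAbs)]; linarith [le_abs_self ((κ i).valMinAbs)]]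
  have hinj : Set.InjOn f ↑(Finset.univ.filter fun κ : Fin d → ZMod M => supNorm κ < 2 ^ (m + 1)) := by
    intro κ _ κ' _ h
    funext i
    have := congrFun h i
    simp only [hf] at this
    exact ZMod.valMinAbs_inj.1 this
  calc ((Finset.univ.filter fun κ : Fin d → ZMod M => supNorm κ < 2 ^ (m + 1)).card : ℕ)
      ≤ (Fintype.piFinset fun _ : Fin d => S).card := Finset.card_le_card_of_injOn f hmaps hinj
    _ = S.card ^ d := Fintype.card_piFinset_const S d
    _ ≤ (2 ^ (m + 2)) ^ d := Nat.pow_le_pow_left hcardS d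

/-! ## Two geometric series -/

/-- `Σ_{m<T} min(y 2^m, (y 2^m)^{-1}) ≤ 4` for every `y > 0`. [cite: Buchholz2016, App. A (A.16)] -/
theorem sum_min_geom_le (y : ℝ) (hy : 0 < y) (T : ℕ) :
    ∑ m ∈ Finset.range T, min (y * 2 ^ m) ((y * 2 ^ m)⁻¹) ≤ 4 := by
  -- split at `y 2^m ≤ 1`
  set P : ℕ → Prop := fun m => y * 2 ^ m ≤ 1 with hP
  classical
  rw [← Finset.sum_filter_add_sum_filter_not (Finset.range T) P]
  have hA : ∑ m ∈ (Finset.range T).filter P, min (y * 2 ^ m) ((y * 2 ^ m)⁻¹) ≤ 2 := by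
    rcases ((Finset.range T).filter P).eq_empty_or_nonempty with he | hne
    · rw [he, Finset.sum_empty]; norm_num
    · obtain ⟨m₁, hm₁, hmax⟩ := Finset.exists_max_image _ id hne
      rw [Finset.mem_filter] at hm₁
      calc ∑ m ∈ (Finset.range T).filter P, min (y * 2 ^ m) ((y * 2 ^ m)⁻¹)
          ≤ ∑ m ∈ (Finset.range T).filter P, y * 2 ^ m := sum_le_sum fun m _ => min_le_left _ _
        _ ≤ ∑ m ∈ Finset.range (m₁ + 1), y * 2 ^ m := by
            refine Finset.sum_le_sum_of_subset_of_nonneg (fun m hm => Finset.mem_range.2 ?_) fun _ _ _ => by positivity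
            have := hmax m hm; simp only [id] at this; omega
        _ = y * (2 ^ (m₁ + 1) - 1) := by
            rw [← Finset.mul_sum, geom_sum_eq (by norm_num)]; norm_num
        _ ≤ 2 * (y * 2 ^ m₁) := by rw [pow_succ]; nlinarith
        _ ≤ 2 := by have : y * 2 ^ m₁ ≤ 1 := hm₁.2; linarith
  have hB : ∑ m ∈ (Finset.range T).filter (fun m => ¬P m), min (y * 2 ^ m) ((y * 2 ^ m)⁻¹) ≤ 2 := by
    rcases ((Finset.range T).filter fun m => ¬P m).eq_empty_or_nonempty with he | hne
    · rw [he, Finset.sum_empty]; norm_num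
    · obtain ⟨m₀, hm₀, hmin⟩ := Finset.exists_min_image _ id hne
      rw [Finset.mem_filter] at hm₀
      have hy0 : 1 < y * 2 ^ m₀ := lt_of_not_ge hm₀.2
      calc ∑ m ∈ (Finset.range T).filter (fun m => ¬P m), min (y * 2 ^ m) ((y * 2 ^ m)⁻¹)
          ≤ ∑ m ∈ (Finset.range T).filter (fun m => ¬P m), (y * 2 ^ m)⁻¹ := sum_le_sum fun m _ => min_le_right _ _
        _ ≤ ∑ m ∈ Finset.Ico m₀ T, (y * 2 ^ m)⁻¹ := by
            refine Finset.sum_le_sum_of_subset_of_nonneg (fun m hm => ?_) fun _ _ _ => by positivity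
            have h1 := hmin m hm
            rw [Finset.mem_filter, Finset.mem_range] at hm
            simp only [id] at h1
            exact Finset.mem_Ico.2 ⟨h1, hm.1⟩
        _ = ∑ i ∈ Finset.range (T - m₀), (y * 2 ^ m₀)⁻¹ * (2⁻¹) ^ i := by
            rw [Finset.sum_Ico_eq_sum_range]
            refine sum_congr rfl fun i _ => ?_
            rw [pow_add, inv_pow]; field_simp
        _ = (y * 2 ^ m₀)⁻¹ * ∑ i ∈ Finset.range (T - m₀), (2⁻¹ : ℝ) ^ i := by rw [Finset.mul_sum]
        _ ≤ (y * 2 ^ m₀)⁻¹ * 2 := by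
            refine mul_le_mul_of_nonneg_left ?_ (by positivity)
            rw [geom_sum_eq (by norm_num)]
            have : (0 : ℝ) < (2⁻¹ : ℝ) ^ (T - m₀) := by positivity
            have h2 : ((2⁻¹ : ℝ) ^ (T - m₀) - 1) / (2⁻¹ - 1) = 2 * (1 - (2⁻¹ : ℝ) ^ (T - m₀)) := by
              field_simp; ring
            rw [h2]; linarith
        _ ≤ 1 * 2 := by
            refine mul_le_mul_of_nonneg_right (inv_le_one_of_one_le₀ hy0.le) (by norm_num)
        _ = 2 := one_mul _
  linarith

/-- `Σ_{m<T} (2^e)^m ≤ 2 (2^e)^{T-1}` for `e ≥ 1`, `T ≥ 1`. [cite: Buchholz2016, App. A (A.16)] -/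
theorem sum_pow_two_pow_le {e T : ℕ} (he : 1 ≤ e) (hT : 1 ≤ T) :
    ∑ m ∈ Finset.range T, ((2 : ℝ) ^ e) ^ m ≤ 2 * ((2 : ℝ) ^ e) ^ (T - 1) := by
  set q : ℝ := (2 : ℝ) ^ e with hq
  have hq2 : 2 ≤ q := by
    rw [hq]
    calc (2 : ℝ) = 2 ^ 1 := (pow_one _).symm
      _ ≤ 2 ^ e := pow_le_pow_right₀ (by norm_num) he
  rw [geom_sum_eq (by linarith)]
  obtain ⟨T', rfl⟩ : ∃ T', T = T' + 1 := ⟨T - 1, by omega⟩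
  rw [Nat.add_sub_cancel, div_le_iff₀ (by linarith), pow_succ]
  have : 0 ≤ q ^ T' := by positivity
  nlinarith

/-! ## The lattice sum -/

/-- **Dyadic lattice-sum estimate**: for `d ≥ 3`, `s ≥ 0`, `2j ≥ d − 1 + s` there is `C` such that for all
`M ≥ 1` and `R > 0`,
`M^{-d} Σ_{κ≠0} |p|^s |p|^{-2} min(1, (R|p|)^{-2j}) ≤ C min(1, R^{-(d-2+s)})`.
[cite: Buchholz2016, App. A (A.12)–(A.16)] -/
theorem exists_latticeSum_le (d s j : ℕ) (hd : 3 ≤ d) (hj : d + s ≤ 2 * j + 1) : ∃ C, 0 ≤ C ∧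
    ∀ (M : ℕ) [NeZero M] (R : ℝ), 0 < R →
      (((M : ℝ) ^ d))⁻¹ * ∑ κ ∈ (Finset.univ : Finset (Fin d → ZMod M)).erase 0,
          momNorm κ ^ s * ((momNorm κ ^ 2)⁻¹ * min 1 ((R * momNorm κ)⁻¹ ^ (2 * j))) ≤
        C * min 1 (R⁻¹ ^ (d - 2 + s)) := by
  set e : ℕ := d - 2 + s with he
  have he1 : 1 ≤ e := by omega
  -- the block constant
  set C₁ : ℝ := (2 / π) ^ d * (2 * d) ^ s with hC₁
  have hC₁0 : 0 < C₁ := by positivity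
  refine ⟨max (4 * C₁) (2 * C₁ * (2 * π) ^ e), le_max_of_le_left (by positivity), fun M _ R hR => ?_⟩
  have hM : (0 : ℝ) < M := by exact_mod_cast Nat.pos_of_ne_zero (NeZero.ne M)
  classical
  set S : Finset (Fin d → ZMod M) := (Finset.univ : Finset (Fin d → ZMod M)).erase 0 with hSdef
  set f : (Fin d → ZMod M) → ℝ := fun κ => momNorm κ ^ s * ((momNorm κ ^ 2)⁻¹ * min 1 ((R * momNorm κ)⁻¹ ^ (2 * j)))
    with hf
  have hf0 : ∀ κ, 0 ≤ f κ := fun κ => by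
    simp only [hf]; have := momNorm_nonneg κ; positivity
  -- dyadic index and its range
  set T : ℕ := Nat.log 2 M + 1 with hT
  set blk : (Fin d → ZMod M) → ℕ := fun κ => Nat.log 2 (supNorm κ) with hblk
  have hmaps : ∀ κ ∈ S, blk κ ∈ Finset.range T := by
    intro κ _
    rw [Finset.mem_range, hT, Nat.lt_succ_iff]
    exact Nat.log_mono_right (supNorm_le κ)
  rw [← Finset.sum_fiberwise_of_maps_to hmaps]
  -- the scale `ρ_m = 2π 2^m / M`
  set ρ : ℕ → ℝ := fun m => 2 * π * 2 ^ m / M with hρ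
  have hρpos : ∀ m, 0 < ρ m := fun m => by simp only [hρ]; positivity
  -- bound on one block
  have hblock : ∀ m ∈ Finset.range T, ∑ κ ∈ S with blk κ = m, f κ ≤
      (M : ℝ) ^ d * C₁ * (ρ m ^ e * min 1 ((R * ρ m)⁻¹ ^ (2 * j))) := by
    intro m _
    -- pointwise bound on the block
    have hpt : ∀ κ ∈ S.filter (fun κ => blk κ = m), f κ ≤
        (2 * d) ^ s * ρ m ^ s * (ρ m ^ 2)⁻¹ * min 1 ((R * ρ m)⁻¹ ^ (2 * j)) := by
      intro κ hκ
      rw [Finset.mem_filter, hSdef, Finset.mem_erase] at hκ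
      have hκ0 : κ ≠ 0 := hκ.1.1
      have hbm : Nat.log 2 (supNorm κ) = m := hκ.2
      have h1 := one_le_supNorm hκ0
      have hlow : 2 ^ m ≤ supNorm κ := by rw [← hbm]; exact Nat.pow_log_le_self 2 (by omega)
      have hup : supNorm κ < 2 ^ (m + 1) := by rw [← hbm]; exact Nat.lt_pow_succ_log_self (by norm_num) _
      have hlow' : ρ m ≤ momNorm κ := by
        refine le_trans ?_ (supNorm_le_momNorm κ)
        simp only [hρ]
        rw [show 2 * π * (2 : ℝ) ^ m / M = 2 * π / M * 2 ^ m by ring]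
        gcongr
        exact_mod_cast hlow
      have hup' : momNorm κ ≤ 2 * d * ρ m := by
        refine (momNorm_le_supNorm κ).trans ?_
        have : (supNorm κ : ℝ) ≤ 2 * 2 ^ m := by
          have := (show (supNorm κ : ℝ) ≤ (2 : ℝ) ^ (m + 1) by exact_mod_cast hup.le)
          rw [pow_succ] at this; linarith
        simp only [hρ]
        calc 2 * π * d / M * (supNorm κ : ℝ) ≤ 2 * π * d / M * (2 * 2 ^ m) := by gcongr
          _ = 2 * d * (2 * π * 2 ^ m / M) := by ring
      have hp0 : 0 < momNorm κ := momNorm_pos hκ0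
      simp only [hf]
      have e1 : momNorm κ ^ s ≤ (2 * d) ^ s * ρ m ^ s := by
        rw [← mul_pow]; exact pow_le_pow_left₀ hp0.le hup' s
      have e2 : (momNorm κ ^ 2)⁻¹ ≤ (ρ m ^ 2)⁻¹ := by
        rw [inv_le_inv₀ (by positivity) (by positivity)]
        exact pow_le_pow_left₀ (hρpos m).le hlow' 2
      have e3 : min 1 ((R * momNorm κ)⁻¹ ^ (2 * j)) ≤ min 1 ((R * ρ m)⁻¹ ^ (2 * j)) := by
        refine min_le_min le_rfl (pow_le_pow_left₀ (by positivity) ?_ _)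
        rw [inv_le_inv₀ (by positivity) (by positivity)]
        gcongr
      calc momNorm κ ^ s * ((momNorm κ ^ 2)⁻¹ * min 1 ((R * momNorm κ)⁻¹ ^ (2 * j)))
          ≤ ((2 * d) ^ s * ρ m ^ s) * ((ρ m ^ 2)⁻¹ * min 1 ((R * ρ m)⁻¹ ^ (2 * j))) := by
            refine mul_le_mul e1 (mul_le_mul e2 e3 (by positivity) (by positivity)) (by positivity) (by positivity)
        _ = (2 * d) ^ s * ρ m ^ s * (ρ m ^ 2)⁻¹ * min 1 ((R * ρ m)⁻¹ ^ (2 * j)) := by ring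
    -- cardinality of the block
    have hcard : ((S.filter (fun κ => blk κ = m)).card : ℝ) ≤ (2 : ℝ) ^ ((m + 2) * d) := by
      have h1 : (S.filter (fun κ => blk κ = m)).card ≤
          (Finset.univ.filter fun κ : Fin d → ZMod M => supNorm κ < 2 ^ (m + 1)).card := by
        refine Finset.card_le_card fun κ hκ => ?_
        rw [Finset.mem_filter, hSdef, Finset.mem_erase] at hκ
        rw [Finset.mem_filter]
        refine ⟨Finset.mem_univ _, ?_⟩
        rw [← hκ.2]; exact Nat.lt_pow_succ_log_self (by norm_num) _
      have h2 := card_supNorm_lt_le (d := d) (M := M) m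
      calc ((S.filter (fun κ => blk κ = m)).card : ℝ) ≤ (((2 ^ (m + 2)) ^ d : ℕ) : ℝ) := by exact_mod_cast h1.trans h2
        _ = (2 : ℝ) ^ ((m + 2) * d) := by push_cast; rw [← pow_mul]
    calc ∑ κ ∈ S with blk κ = m, f κ
        ≤ ∑ κ ∈ S with blk κ = m, (2 * d) ^ s * ρ m ^ s * (ρ m ^ 2)⁻¹ * min 1 ((R * ρ m)⁻¹ ^ (2 * j)) := sum_le_sum hpt
      _ = ((S.filter (fun κ => blk κ = m)).card : ℝ) * ((2 * d) ^ s * ρ m ^ s * (ρ m ^ 2)⁻¹ * min 1 ((R * ρ m)⁻¹ ^ (2 * j))) := by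
          rw [sum_const, nsmul_eq_mul]
      _ ≤ (2 : ℝ) ^ ((m + 2) * d) * ((2 * d) ^ s * ρ m ^ s * (ρ m ^ 2)⁻¹ * min 1 ((R * ρ m)⁻¹ ^ (2 * j))) := by
          refine mul_le_mul_of_nonneg_right hcard ?_
          have := hρpos m; positivity
      _ = (M : ℝ) ^ d * C₁ * (ρ m ^ e * min 1 ((R * ρ m)⁻¹ ^ (2 * j))) := by
          -- `2^{(m+2)d} = (2/π)^d M^d ρ_m^d` and `ρ^d ρ^s ρ^{-2} = ρ^e`
          have h2m : (2 : ℝ) ^ ((m + 2) * d) = (2 / π) ^ d * (M : ℝ) ^ d * ρ m ^ d := by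
            rw [pow_mul, ← mul_pow, ← mul_pow]
            congr 1
            simp only [hρ]; field_simp; ring
          have hρe : ρ m ^ d * (ρ m ^ s * (ρ m ^ 2)⁻¹) = ρ m ^ e := by
            rw [he, show d - 2 + s = (d - 2) + s from rfl, pow_add]
            have : ρ m ^ d = ρ m ^ (d - 2) * ρ m ^ 2 := by rw [← pow_add]; congr 1; omega
            have hρ0 : ρ m ≠ 0 := (hρpos m).ne'
            rw [this]; field_simp
          rw [h2m, hC₁, ← hρe]; ring
  -- sum the blocks
  have hsum : ∑ m ∈ Finset.range T, ∑ κ ∈ S with blk κ = m, f κ ≤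
      (M : ℝ) ^ d * C₁ * ∑ m ∈ Finset.range T, ρ m ^ e * min 1 ((R * ρ m)⁻¹ ^ (2 * j)) := by
    rw [Finset.mul_sum]; exact sum_le_sum hblock
  -- (i) the crude bound `Σ ρ_m^e ≤ 2 (2π)^e`
  have hT1 : 1 ≤ T := by omega
  have hgeom1 : ∑ m ∈ Finset.range T, ρ m ^ e * min 1 ((R * ρ m)⁻¹ ^ (2 * j)) ≤ 2 * (2 * π) ^ e := by
    calc ∑ m ∈ Finset.range T, ρ m ^ e * min 1 ((R * ρ m)⁻¹ ^ (2 * j))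
        ≤ ∑ m ∈ Finset.range T, ρ m ^ e := sum_le_sum fun m _ => by
          have := hρpos m
          exact mul_le_of_le_one_right (by positivity) (min_le_left _ _)
      _ = (2 * π / M) ^ e * ∑ m ∈ Finset.range T, ((2 : ℝ) ^ e) ^ m := by
          rw [Finset.mul_sum]
          refine sum_congr rfl fun m _ => ?_
          simp only [hρ]
          rw [← pow_mul, mul_comm e m, pow_mul, ← mul_pow]
          congr 1; ring
      _ ≤ (2 * π / M) ^ e * (2 * ((2 : ℝ) ^ e) ^ (T - 1)) :=
          mul_le_mul_of_nonneg_left (sum_pow_two_pow_le he1 hT1) (by positivity)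
      _ = 2 * (2 * π * 2 ^ (T - 1) / M) ^ e := by
          rw [← pow_mul, mul_comm e (T - 1), pow_mul, div_pow, div_pow, mul_pow (2 * π)]; ring
      _ ≤ 2 * (2 * π) ^ e := by
          have hpow : (2 : ℝ) ^ (T - 1) ≤ M := by
            rw [hT, Nat.add_sub_cancel]
            exact_mod_cast Nat.pow_log_le_self 2 (NeZero.ne M)
          have : 2 * π * (2 : ℝ) ^ (T - 1) / M ≤ 2 * π := by
            rw [div_le_iff₀ hM]
            calc 2 * π * (2 : ℝ) ^ (T - 1) ≤ 2 * π * M := by gcongr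
              _ = 2 * π * M := rfl
          gcongr
  -- (ii) the decay bound `Σ ≤ 4 R^{-e}`
  have hgeom2 : ∑ m ∈ Finset.range T, ρ m ^ e * min 1 ((R * ρ m)⁻¹ ^ (2 * j)) ≤ 4 * R⁻¹ ^ e := by
    have hterm : ∀ m ∈ Finset.range T, ρ m ^ e * min 1 ((R * ρ m)⁻¹ ^ (2 * j)) ≤
        R⁻¹ ^ e * min (R * ρ 0 * 2 ^ m) ((R * ρ 0 * 2 ^ m)⁻¹) := by
      intro m _
      have hz : R * ρ 0 * 2 ^ m = R * ρ m := by simp only [hρ]; ring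
      rw [hz]
      set z : ℝ := R * ρ m with hzdef
      have hzpos : 0 < z := by have := hρpos m; positivity
      have hρz : ρ m = R⁻¹ * z := by rw [hzdef]; field_simp
      rw [hρz, mul_pow, mul_assoc]
      refine mul_le_mul_of_nonneg_left ?_ (by positivity)
      -- `z^e min(1, z^{-2j}) ≤ min(z, z^{-1})`
      rcases le_or_gt z 1 with hz1 | hz1
      · have hmin : min z z⁻¹ = z := min_eq_left (by
          calc z ≤ 1 := hz1
            _ ≤ z⁻¹ := one_le_inv_iff₀.2 ⟨hzpos, hz1⟩)
        rw [hmin]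
        calc z ^ e * min 1 (z⁻¹ ^ (2 * j)) ≤ z ^ e * 1 :=
              mul_le_mul_of_nonneg_left (min_le_left _ _) (by positivity)
          _ ≤ z ^ 1 := by rw [mul_one]; exact pow_le_pow_of_le_one hzpos.le hz1 he1
          _ = z := pow_one z
      · have hmin : min z z⁻¹ = z⁻¹ := min_eq_right (by
          calc z⁻¹ ≤ 1 := inv_le_one_of_one_le₀ hz1.le
            _ ≤ z := hz1.le)
        rw [hmin]
        calc z ^ e * min 1 (z⁻¹ ^ (2 * j)) ≤ z ^ e * z⁻¹ ^ (2 * j) :=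
              mul_le_mul_of_nonneg_left (min_le_right _ _) (by positivity)
          _ = z⁻¹ ^ (2 * j - e) := by
              have hsplit : z⁻¹ ^ (2 * j) = z⁻¹ ^ e * z⁻¹ ^ (2 * j - e) := by rw [← pow_add]; congr 1; omega
              rw [hsplit, ← mul_assoc, ← mul_pow, mul_inv_cancel₀ hzpos.ne', one_pow, one_mul]
          _ ≤ z⁻¹ ^ 1 := pow_le_pow_of_le_one (by positivity) (inv_le_one_of_one_le₀ hz1.le) (by omega)
          _ = z⁻¹ := pow_one _
    calc ∑ m ∈ Finset.range T, ρ m ^ e * min 1 ((R * ρ m)⁻¹ ^ (2 * j))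
        ≤ ∑ m ∈ Finset.range T, R⁻¹ ^ e * min (R * ρ 0 * 2 ^ m) ((R * ρ 0 * 2 ^ m)⁻¹) := sum_le_sum hterm
      _ = R⁻¹ ^ e * ∑ m ∈ Finset.range T, min (R * ρ 0 * 2 ^ m) ((R * ρ 0 * 2 ^ m)⁻¹) := by rw [Finset.mul_sum]
      _ ≤ R⁻¹ ^ e * 4 :=
          mul_le_mul_of_nonneg_left (sum_min_geom_le (R * ρ 0) (by have := hρpos 0; positivity) T) (by positivity)
      _ = 4 * R⁻¹ ^ e := mul_comm _ _
  -- combine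
  have hMd : (0 : ℝ) < (M : ℝ) ^ d := by positivity
  rw [show (((M : ℝ) ^ d))⁻¹ * ∑ m ∈ Finset.range T, ∑ κ ∈ S with blk κ = m, f κ =
      (∑ m ∈ Finset.range T, ∑ κ ∈ S with blk κ = m, f κ) / (M : ℝ) ^ d by rw [inv_mul_eq_div],
    div_le_iff₀ hMd]
  refine hsum.trans ?_
  rcases le_or_gt 1 (R⁻¹ ^ e) with h1 | h1
  · -- `R ≤ 1`: use (i)
    rw [min_eq_left h1]
    calc (M : ℝ) ^ d * C₁ * ∑ m ∈ Finset.range T, ρ m ^ e * min 1 ((R * ρ m)⁻¹ ^ (2 * j))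
        ≤ (M : ℝ) ^ d * C₁ * (2 * (2 * π) ^ e) := mul_le_mul_of_nonneg_left hgeom1 (by positivity)
      _ = 2 * C₁ * (2 * π) ^ e * 1 * (M : ℝ) ^ d := by ring
      _ ≤ max (4 * C₁) (2 * C₁ * (2 * π) ^ e) * 1 * (M : ℝ) ^ d := by gcongr; exact le_max_right _ _
  · -- `R > 1`: use (ii)
    rw [min_eq_right h1.le]
    calc (M : ℝ) ^ d * C₁ * ∑ m ∈ Finset.range T, ρ m ^ e * min 1 ((R * ρ m)⁻¹ ^ (2 * j))
        ≤ (M : ℝ) ^ d * C₁ * (4 * R⁻¹ ^ e) := mul_le_mul_of_nonneg_left hgeom2 (by positivity)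
      _ = 4 * C₁ * R⁻¹ ^ e * (M : ℝ) ^ d := by ring
      _ ≤ max (4 * C₁) (2 * C₁ * (2 * π) ^ e) * R⁻¹ ^ e * (M : ℝ) ^ d := by gcongr; exact le_max_left _ _

end Literature.MathematicalPhysics.StatisticalMechanics.GradientFRD

end
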